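import Literature.Topology.FourManifolds.GluingConstruction
import Literature.Geometry.Manifold.SmoothEmbeddingInverse
import Literature.Geometry.Symplectic.AlmostComplexStructure
import Mathlib.Geometry.Manifold.ContMDiffMFDeriv

/-!
# Wedge cap for `GromovRecognitionRelEnd` — gluing almost complex structures along a pushout
(stub `stub_capModel` of line `cross-cap-laurent`, crux `SymplecticOrigami.GromovRecognitionRelEnd`,
item stmt-SmoothPoincare4-11009; generic auxiliary file)

Generic differential topology used to put the complex structure on the wedge cap
`X = M ∪ (V∞ ∪ H∞)`, which is built as an iterated open gluing
(`Literature.Topology.FourManifolds.SmoothGlueData.Glued`, Kosinski VI.1):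

* **push-forward of an endomorphism field along an open smooth embedding** `e : P → X`
  (`pushEnd e J y = de ∘ J ∘ d(e⁻¹)` on `range e`): it is a `C^∞` section of `End(TX)` near every
  point of `range e` when `J` is (`contMDiffAt_pushforwardEnd`, `contMDiffAt_pushEnd`: the
  hom-bundle coordinates of `de ∘ J ∘ de⁻¹` factor as `(de in coordinates) ∘ (J in coordinates) ∘
  (de⁻¹ in coordinates)`, three `C^∞` matrix-valued maps), squares to `-1` (`pushEnd_pushEnd`) and
  makes `e` holomorphic (`pushEnd_mfderiv`);
* **gluing** (`SmoothGlueData.exists_almostComplexStructure`): almost complex structures `J_A`,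
  `J_B` on the pieces for which the gluing map is holomorphic descend to an almost complex
  structure on `A ∪_glue B` for which both pieces are holomorphically embedded
  (McDuff–Salamon 2017, §4.1: `J` is local data, a section of `End(TM)`).
-/

noncomputable section

-- the registered namespace `Summit.SmoothPoincare4.SmoothPoincare4.Theorems…` repeats a component
set_option linter.dupNamespace false

open scoped Manifold ContDiff Topology
open Bundle Set Function Filter Literature.Geometry.Symplectic

namespace Summit.SmoothPoincare4.SmoothPoincare4.Theorems.GromovRecognitionRelEnd.CrossCapLaurent

namespace CapModel

variable {E : Type*} [NormedAddCommGroup E] [NormedSpace ℝ E] {H : Type*} [TopologicalSpace H]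
  {I : ModelWithCorners ℝ E H} {P : Type*} [TopologicalSpace P] [ChartedSpace H P]
  {E' : Type*} [NormedAddCommGroup E'] [NormedSpace ℝ E'] {H' : Type*} [TopologicalSpace H']
  {I' : ModelWithCorners ℝ E' H'} {X : Type*} [TopologicalSpace X] [ChartedSpace H' X]

/-! ## Push-forward of an endomorphism field: smoothness in the hom bundle -/

/-- Changing the base points of `inCoordinates` along propositional equalities. [folklore] -/
theorem inCoordinates_congr [IsManifold I ∞ P] [IsManifold I' ∞ X] {x₀ x : P} {y₀ y y₀' y' : X}
    (h₀ : y₀ = y₀') (h : y = y') (ϕ : E →L[ℝ] E') :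
    ContinuousLinearMap.inCoordinates E (TangentSpace I) E' (TangentSpace I') x₀ x y₀ y ϕ =
      ContinuousLinearMap.inCoordinates E (TangentSpace I) E' (TangentSpace I') x₀ x y₀' y' ϕ := by
  subst h₀ h; rfl

/-- **Push-forward of a smooth endomorphism field is smooth.** Let `e : P → X` be `C^∞` at
`einv y₀`, `einv : X → P` be `C^∞` at `y₀` with `e ∘ einv = id` near `y₀`, and let `J` be a field of
endomorphisms of `TP` which is a `C^∞` section of `End(TP)` at `einv y₀`. Then
`y ↦ de_{einv y} ∘ J_{einv y} ∘ d(einv)_y` is a `C^∞` section of `End(TX)` at `y₀`: in the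
trivialisations at `y₀` and `einv y₀` it is the product of the coordinate expressions of `de`
(`ContMDiffAt.mfderiv_const`), of `J`, and of `d(einv)`. [cite: McDuffSalamon2017, §4.1] -/
theorem contMDiffAt_pushforwardEnd [IsManifold I ∞ P] [IsManifold I' ∞ X]
    {e : P → X} {einv : X → P} {y₀ : X}
    (he : ContMDiffAt I I' ∞ e (einv y₀)) (heinv : ContMDiffAt I' I ∞ einv y₀)
    (hleft : ∀ᶠ y in 𝓝 y₀, e (einv y) = y)
    {J : (p : P) → TangentSpace I p →L[ℝ] TangentSpace I p}
    (hJ : ContMDiffAt I (I.prod 𝓘(ℝ, E →L[ℝ] E)) ∞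
      (fun p => TotalSpace.mk' (E →L[ℝ] E)
        (E := fun p : P => TangentSpace I p →L[ℝ] TangentSpace I p) p (J p)) (einv y₀)) :
    ContMDiffAt I' (I'.prod 𝓘(ℝ, E' →L[ℝ] E')) ∞
      (fun y => TotalSpace.mk' (E' →L[ℝ] E')
        (E := fun y : X => TangentSpace I' y →L[ℝ] TangentSpace I' y) y
        ((mfderiv I I' e (einv y)).comp ((J (einv y)).comp (mfderiv I' I einv y)))) y₀ := by
  set p₀ := einv y₀ with hp₀
  have hy₀ : e p₀ = y₀ := hleft.self_of_nhds
  rw [contMDiffAt_hom_bundle]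
  refine ⟨contMDiffAt_id, ?_⟩
  simp only
  set TX := trivializationAt E' (TangentSpace I' : X → Type _) y₀ with hTX
  set TP := trivializationAt E (TangentSpace I : P → Type _) p₀ with hTP
  set F1 : X → E →L[ℝ] E' := fun y =>
    (TX.continuousLinearMapAt ℝ y).comp ((mfderiv I I' e (einv y)).comp (TP.symmL ℝ (einv y)))
    with hF1
  set F2 : X → E →L[ℝ] E := fun y =>
    (TP.continuousLinearMapAt ℝ (einv y)).comp ((J (einv y)).comp (TP.symmL ℝ (einv y))) with hF2
  set F3 : X → E' →L[ℝ] E := fun y =>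
    (TP.continuousLinearMapAt ℝ (einv y)).comp ((mfderiv I' I einv y).comp (TX.symmL ℝ y)) with hF3
  have h1 : ContMDiffAt I' 𝓘(ℝ, E →L[ℝ] E') ∞ F1 y₀ := by
    have h := (he.mfderiv_const (m := ∞) le_rfl).comp y₀ heinv
    refine h.congr_of_eventuallyEq ?_
    filter_upwards [hleft] with y hy
    simp only [Function.comp_apply, inTangentCoordinates, hF1]
    rw [inCoordinates_congr (I := I) (I' := I') hy₀ hy]
    rfl
  have h2 : ContMDiffAt I' 𝓘(ℝ, E →L[ℝ] E) ∞ F2 y₀ :=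
    ((contMDiffAt_hom_bundle _).1 hJ).2.comp y₀ heinv
  have h3 : ContMDiffAt I' 𝓘(ℝ, E' →L[ℝ] E) ∞ F3 y₀ := heinv.mfderiv_const (m := ∞) le_rfl
  refine (h1.clm_comp (h2.clm_comp h3)).congr_of_eventuallyEq ?_
  have hP : ∀ᶠ y in 𝓝 y₀, einv y ∈ (chartAt H p₀).source :=
    heinv.continuousAt.preimage_mem_nhds
      ((chartAt H p₀).open_source.mem_nhds (mem_chart_source H p₀))
  filter_upwards [hP] with y hy
  have hyb : einv y ∈ TP.baseSet := by
    simpa only [hTP, TangentBundle.trivializationAt_baseSet] using hy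
  ext v
  change TX.continuousLinearMapAt ℝ y (mfderiv I I' e (einv y) (J (einv y)
      (mfderiv I' I einv y (TX.symmL ℝ y v)))) =
    TX.continuousLinearMapAt ℝ y (mfderiv I I' e (einv y) (TP.symmL ℝ (einv y)
      (TP.continuousLinearMapAt ℝ (einv y) (J (einv y) (TP.symmL ℝ (einv y)
        (TP.continuousLinearMapAt ℝ (einv y) (mfderiv I' I einv y (TX.symmL ℝ y v))))))))
  rw [TP.symmL_continuousLinearMapAt hyb, TP.symmL_continuousLinearMapAt hyb]

/-! ## Open smooth embeddings: the inverse and its differential -/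

section Emb

variable [Nonempty P] {e : P → X}

omit [TopologicalSpace P] [TopologicalSpace X] in
/-- The inverse of an injective map is a left inverse. [folklore] -/
theorem invFun_apply (hinj : Injective e) (p : P) : invFun e (e p) = p := leftInverse_invFun hinj p

omit [TopologicalSpace P] [TopologicalSpace X] in
/-- On the range, the inverse is a right inverse. [folklore] -/
theorem apply_invFun {y : X} (hy : y ∈ range e) : e (invFun e y) = y := invFun_eq hy

omit [TopologicalSpace P] in
/-- On the (open) range, `e ∘ e⁻¹ = id` near every point. [folklore] -/
theorem eventually_apply_invFun (hop : IsOpen (range e)) {y : X} (hy : y ∈ range e) :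
    ∀ᶠ y' in 𝓝 y, e (invFun e y') = y' := by
  filter_upwards [hop.mem_nhds hy] with y' hy'
  exact apply_invFun hy'

/-- The inverse of a smooth embedding with open range is `C^∞` at the points of the range.
[cite: LeeSmoothManifolds2013, Prop. 4.22] -/
theorem contMDiffAt_invFun (hem : Manifold.IsSmoothEmbedding I I' ∞ e) (hop : IsOpen (range e))
    {y : X} (hy : y ∈ range e) : ContMDiffAt I' I ∞ (invFun e) y :=
  (Literature.Geometry.Manifold.contMDiffOn_invFun_range hem y hy).contMDiffAt (hop.mem_nhds hy)

/-- Near a point of the range, the inverse is `C^∞`. [folklore] -/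
theorem eventually_contMDiffAt_invFun (hem : Manifold.IsSmoothEmbedding I I' ∞ e)
    (hop : IsOpen (range e)) {y : X} (hy : y ∈ range e) :
    ∀ᶠ y' in 𝓝 y, ContMDiffAt I' I ∞ (invFun e) y' := by
  filter_upwards [hop.mem_nhds hy] with y' hy'
  exact contMDiffAt_invFun hem hop hy'

/-- **`d(e⁻¹) ∘ de = id`.** [folklore] -/
theorem mfderiv_invFun_comp_mfderiv (hem : Manifold.IsSmoothEmbedding I I' ∞ e)
    (hop : IsOpen (range e)) (p : P) :
    (mfderiv I' I (invFun e) (e p)).comp (mfderiv I I' e p) =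
      ContinuousLinearMap.id ℝ (TangentSpace I p) := by
  have hinj := hem.isEmbedding.injective
  have h1 : MDifferentiableAt I I' e p := (hem.contMDiff p).mdifferentiableAt (by simp)
  have h2 : MDifferentiableAt I' I (invFun e) (e p) :=
    (contMDiffAt_invFun hem hop (mem_range_self p)).mdifferentiableAt (by simp)
  rw [← mfderiv_comp p h2 h1, show invFun e ∘ e = id from funext fun q => invFun_apply hinj q,
    mfderiv_id]

/-- **`de ∘ d(e⁻¹) = id` at the points of the range.** [folklore] -/
theorem mfderiv_comp_mfderiv_invFun (hem : Manifold.IsSmoothEmbedding I I' ∞ e)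
    (hop : IsOpen (range e)) {y : X} (hy : y ∈ range e) :
    (mfderiv I I' e (invFun e y)).comp (mfderiv I' I (invFun e) y) =
      ContinuousLinearMap.id ℝ (TangentSpace I' y) := by
  have h1 : MDifferentiableAt I I' e (invFun e y) :=
    (hem.contMDiff _).mdifferentiableAt (by simp)
  have h2 : MDifferentiableAt I' I (invFun e) y :=
    (contMDiffAt_invFun hem hop hy).mdifferentiableAt (by simp)
  have hev : (e ∘ invFun e) =ᶠ[𝓝 y] id := eventually_apply_invFun hop hy
  rw [← mfderiv_comp y h1 h2, hev.mfderiv_eq, mfderiv_id]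

/-- `d(e⁻¹)_{e p} (de_p v) = v`. [folklore] -/
theorem mfderiv_invFun_apply_mfderiv (hem : Manifold.IsSmoothEmbedding I I' ∞ e)
    (hop : IsOpen (range e)) (p : P) (v : TangentSpace I p) :
    mfderiv I' I (invFun e) (e p) (mfderiv I I' e p v) = v := by
  have h := mfderiv_invFun_comp_mfderiv hem hop p
  exact congrArg (fun L : TangentSpace I p →L[ℝ] TangentSpace I p => L v) h

/-- `de_{e⁻¹ y} (d(e⁻¹)_y w) = w` on the range. [folklore] -/
theorem mfderiv_apply_mfderiv_invFun (hem : Manifold.IsSmoothEmbedding I I' ∞ e)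
    (hop : IsOpen (range e)) {y : X} (hy : y ∈ range e) (w : TangentSpace I' y) :
    mfderiv I I' e (invFun e y) (mfderiv I' I (invFun e) y w) = w := by
  have h := mfderiv_comp_mfderiv_invFun hem hop hy
  exact congrArg (fun L : TangentSpace I' y →L[ℝ] TangentSpace I' y => L w) h

/-- **`de_p` is surjective** for an open smooth embedding: `w = de_p (d(e⁻¹) w)`. [folklore] -/
theorem mfderiv_surjective (hem : Manifold.IsSmoothEmbedding I I' ∞ e) (hop : IsOpen (range e))
    (p : P) : Surjective (mfderiv I I' e p) := by
  intro w
  refine ⟨mfderiv I' I (invFun e) (e p) w, ?_⟩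
  have h := mfderiv_apply_mfderiv_invFun hem hop (mem_range_self p) w
  rwa [invFun_apply hem.isEmbedding.injective] at h

/-! ## The push-forward of an endomorphism field along an open smooth embedding -/

variable (I I') in
/-- **Push-forward of a field of endomorphisms** `J` of `TP` along `e : P → X`:
`(e_* J)_y = de_{e⁻¹ y} ∘ J_{e⁻¹ y} ∘ d(e⁻¹)_y` (meaningful on `range e`). [cite: McDuffSalamon2017, §4.1] -/
def pushEnd (e : P → X) (J : (p : P) → TangentSpace I p →L[ℝ] TangentSpace I p) (y : X) :
    TangentSpace I' y →L[ℝ] TangentSpace I' y :=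
  (mfderiv I I' e (invFun e y)).comp ((J (invFun e y)).comp (mfderiv I' I (invFun e) y))

/-- **`e` is `(J, e_*J)`-holomorphic**: `(e_* J)_{e p} (de_p v) = de_p (J_p v)`. [folklore] -/
theorem pushEnd_mfderiv (hem : Manifold.IsSmoothEmbedding I I' ∞ e) (hop : IsOpen (range e))
    (J : (p : P) → TangentSpace I p →L[ℝ] TangentSpace I p) (p : P) (v : TangentSpace I p) :
    pushEnd I I' e J (e p) (mfderiv I I' e p v) = mfderiv I I' e p (J p v) := by
  change mfderiv I I' e (invFun e (e p)) (J (invFun e (e p))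
    (mfderiv I' I (invFun e) (e p) (mfderiv I I' e p v))) = _
  rw [mfderiv_invFun_apply_mfderiv hem hop p v, invFun_apply hem.isEmbedding.injective]

/-- The push-forward of an almost complex structure squares to `-1` on the range. [folklore] -/
theorem pushEnd_pushEnd [IsManifold I ∞ P] (hem : Manifold.IsSmoothEmbedding I I' ∞ e)
    (hop : IsOpen (range e)) (J : AlmostComplexStructure I ∞ P) {y : X} (hy : y ∈ range e) (w : TangentSpace I' y) :
    pushEnd I I' e J y (pushEnd I I' e J y w) = -w := by
  obtain ⟨p, rfl⟩ := hy
  obtain ⟨v, rfl⟩ := mfderiv_surjective hem hop p w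
  rw [pushEnd_mfderiv hem hop, pushEnd_mfderiv hem hop, J.map_map, map_neg]

/-- **The push-forward of an almost complex structure is a `C^∞` section of `End(TX)` at the
points of the range.** [cite: McDuffSalamon2017, §4.1] -/
theorem contMDiffAt_pushEnd [IsManifold I ∞ P] [IsManifold I' ∞ X]
    (hem : Manifold.IsSmoothEmbedding I I' ∞ e) (hop : IsOpen (range e))
    (J : AlmostComplexStructure I ∞ P) {y : X} (hy : y ∈ range e) :
    ContMDiffAt I' (I'.prod 𝓘(ℝ, E' →L[ℝ] E')) ∞
      (fun y => TotalSpace.mk' (E' →L[ℝ] E')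
        (E := fun y : X => TangentSpace I' y →L[ℝ] TangentSpace I' y) y (pushEnd I I' e J y)) y :=
  contMDiffAt_pushforwardEnd (hem.contMDiff _) (contMDiffAt_invFun hem hop hy)
    (eventually_apply_invFun hop hy) (J.contMDiff _)

end Emb

end CapModel

/-- **Registered helper sub-goal `helper_capModelEmbeddingSurj`** (generic auxiliary file of stub
`stub_capModel`): the differential of an open smooth embedding of `4`-manifolds is surjective at
every point (it is inverted by the differential of the smooth inverse). [folklore] -/
theorem helper_capModelEmbeddingSurj : ∀ (P X : Type) [TopologicalSpace P]
    [ChartedSpace (EuclideanSpace ℝ (Fin 4)) P] [IsManifold (𝓡 4) ∞ P] [TopologicalSpace X]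
    [ChartedSpace (EuclideanSpace ℝ (Fin 4)) X] [IsManifold (𝓡 4) ∞ X] [Nonempty P] (e : P → X),
    Manifold.IsSmoothEmbedding (𝓡 4) (𝓡 4) ∞ e → IsOpen (Set.range e) →
    ∀ p : P, Function.Surjective (mfderiv (𝓡 4) (𝓡 4) e p) :=
  fun _ _ _ _ _ _ _ _ _ _ hem hop p => CapModel.mfderiv_surjective hem hop p

end Summit.SmoothPoincare4.SmoothPoincare4.Theorems.GromovRecognitionRelEnd.CrossCapLaurent
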